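import Summits.ResolutionOfSingularities.ResolutionOfSingularities.Theorems.EquisingularLiftEquisingularLiftNatFirstProgressTouch
import Summits.ResolutionOfSingularities.ResolutionOfSingularities.Theorems.EquisingularLiftEquisingularLiftNatStageCut
import Summits.ResolutionOfSingularities.ResolutionOfSingularities.Theorems.EquisingularLiftEquisingularLiftNatRegularOfSpecialFibre
import HarnessLib

/-!
# [OURS · L1 W4.5(b) · EL♮] T-REACH-NECESSITY: the useful-touch / first-progress necessity kit for PIECE A `ReachIsolatedAt`
# (the registered refuter-facing stub `stub_elnat_ge_four_reach : GeFourReachIsolated p`, skeleton v8.1) — any `n`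
# (crux `EquisingularLiftNat` = stmt-ResolutionOfSingularities-20038; K-∀n / K5-BMY necessity lane, kill test #50 on piece A)

HONEST FRAMING. OURS (cell res-hironaka, crux chain w45b, slot W4.5(b)); NOT a statement of any manuscript; replaces the role of
NOTHING in the manuscript; AI-written, AI review is weaker than expert review. Helper `--supports stmt-ResolutionOfSingularities-20038
--as helper`. res-L1-w45b-lead-2 RESHAPE v8.1 (11:05:51Z): the ∀ n band is split by STAGES (res-L1-w45b-strat-1 `…NatStageCut`, p525046)
and «the REGISTERED refuter target is now `stub_elnat_ge_four_reach : GeFourReachIsolated p` = piece A». Piece A only asks for a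
HORIZONTAL E1 chain reaching a stage with FINITELY MANY non-regular points (+ good reduction there), not a regular end; this file transports
the necessity kit of res-L1-w45b-lead-1 (T-USEFUL-TOUCH p513560, T-USEFUL-TOUCH-NP p520241, T-FIRST-PROGRESS p525849) to that weaker end
condition.

* `infinite_closure_of_isClosedMap`, `infinite_closure_of_injective` — closure-size bookkeeping;
* `isRegularLocalRing_of_finite_singSet_of_infinite_closure` — at a stage with finite `singSet`, every point of the reduced strict transform
  with INFINITE closure (e.g. a point over `η_S`, `dim S ≥ 1`) is regular (regularity generises: res-type-032's
  `isRegularLocalRing_stalk_of_specializes`, Serre/Matsumura 19.3 `Matsumura1987_19_3_holds`).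
* `exists_useful_touch_of_horizChain_of_regularOver` — USEFUL TOUCH with the end condition weakened to «every point of `V(closure S′)`
  over `x` is regular» (horizontal closure; no regular end needed).
* `exists_first_progress_touch_of_horizChain_of_regularOver` — FIRST PROGRESS touch under the same weak end condition.
* `usefulTouchNonprincipal_of_reachIsolatedAt`, `firstProgressTouch_of_reachIsolatedAt` — THE OBJECTS for piece A: `ReachIsolatedAt p k n H ι`
  ⇒ for every non-regular `h` whose image `x` has INFINITE closure in `ℙⁿ_O`, over A's `(O, π)` and every `φ, Y`: a useful touch over `x`
  with NON-PRINCIPAL trace, and a first progress touch seeing `𝒪_{V(Y), w₀}` up to `≃+*`. A landed negation for one instance refutes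
  `GeFourReachIsolated p` (hence EL♮, stmt-20038) while leaving EL♮(3) untouched.

References: tree `…NatStageCut` (p525046), `…NatRegularOfSpecialFibre`, `…NatFirstProgressTouch` (p525849), `…NatUsefulTouchNonPrincipal`
(p520241), `…NatTraceIso` (p518228), `…NatFirstTouch` (p500156: `nonregular_point_persists`).
-/

set_option linter.dupNamespace false -- mandated namespace `Summit.<Summit>.<Problem>` of this single-conjunct summit
set_option linter.overlappingInstances false -- item signatures carry `[IsDomain O] [IsDiscreteValuationRing O]`

open CategoryTheory AlgebraicGeometry TopologicalSpace Topology
open Literature.AlgebraicGeometry.Resolution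
open AlgebraicGeometry.Scheme.IdealSheafData
open Summit.ResolutionOfSingularities.ResolutionOfSingularities.Theses.EquisingularLift.Split
open Summit.ResolutionOfSingularities.ResolutionOfSingularities.Cruxes.EquisingularLift.StrataSplit
open Summit.ResolutionOfSingularities.ResolutionOfSingularities.Theorems.EquisingularLift
open Summit.ResolutionOfSingularities.ResolutionOfSingularities.Theorems.EquisingularLiftNatStageCut

namespace Summit.ResolutionOfSingularities.ResolutionOfSingularities.Cruxes.EquisingularLiftNat.Sections

/-! ## Finite non-regular locus ⇒ points with infinite closure are regular -/

/-- **At a stage with finitely many non-regular points, every point of the reduced strict transform with INFINITE closure is regular**: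
regularity generises (`isRegularLocalRing_stalk_of_specializes`, Serre), so a non-regular point has a non-regular closure. [folklore] -/
theorem isRegularLocalRing_of_finite_singSet_of_infinite_closure {P' : AlgebraicGeometry.Scheme.{0}} (S' : Set P')
    (hfin : (singSet S').Finite) (w : ↥(AlgebraicGeometry.Scheme.IdealSheafData.vanishingIdeal (⟨closure S', isClosed_closure⟩ : TopologicalSpace.Closeds P')).subscheme) (hw : (closure ({w} : Set ↥(AlgebraicGeometry.Scheme.IdealSheafData.vanishingIdeal (⟨closure S', isClosed_closure⟩ : TopologicalSpace.Closeds P')).subscheme)).Infinite) :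
    IsRegularLocalRing ((AlgebraicGeometry.Scheme.IdealSheafData.vanishingIdeal (⟨closure S', isClosed_closure⟩ : TopologicalSpace.Closeds P')).subscheme.presheaf.stalk w) := by
  by_contra hreg
  apply hw
  refine hfin.subset fun z hz => ?_
  have hsp : w ⤳ z := specializes_iff_mem_closure.mpr hz
  exact fun hz' => hreg (isRegularLocalRing_stalk_of_specializes hsp hz')

/-- A closed map sends a point with infinite-closure image to a point with infinite closure: if `f` is continuous and closed and
`closure {f w}` is infinite then `closure {w}` is infinite. [folklore] -/
theorem infinite_closure_of_isClosedMap {α β : Type*} [TopologicalSpace α] [TopologicalSpace β] {f : α → β} (hf : Continuous f)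
    (hc : IsClosedMap f) (w : α) (h : (closure ({f w} : Set β)).Infinite) : (closure ({w} : Set α)).Infinite := by
  intro hfin
  apply h
  have : closure ({f w} : Set β) ⊆ f '' closure ({w} : Set α) := by
    rw [← Set.image_singleton, ← hc.closure_image_eq_of_continuous hf]
  exact (hfin.image f).subset this

/-- A continuous injection sends a point with infinite closure to a point with infinite closure. [folklore] -/
theorem infinite_closure_of_injective {α β : Type*} [TopologicalSpace α] [TopologicalSpace β] {f : α → β} (hf : Continuous f)
    (hinj : Function.Injective f) (w : α) (h : (closure ({w} : Set α)).Infinite) : (closure ({f w} : Set β)).Infinite := by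
  have hsub : f '' closure ({w} : Set α) ⊆ closure ({f w} : Set β) := by
    have := image_closure_subset_closure_image (s := ({w} : Set α)) hf
    rwa [Set.image_singleton] at this
  exact ((h.image hinj.injOn).mono hsub)

/-! ## USEFUL TOUCH with the weak end condition «regular over `x`» (horizontal closure) -/

/-- **A USEFUL TOUCH EXISTS (horizontal closure, end regular OVER `x` only).** `O` local, `q : P → Spec O` with `P` locally Noetherian,
`Y ⊆ P`, `x ∈ Y` with a NON-regular point of `V(closure Y)` over `x`, and `(P′, σ, S′)` in the HORIZONTAL E1-closure of `(P, 𝟙, Y)` such that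
every point of `V(closure S′)` over `x` is regular. Then some step of the chain is a USEFUL TOUCH over `x`: a stage `(X₁, σ₁, Y₁)` of the
closure, `x₁ ∈ Y₁` over `x` with a non-regular point of `V(closure Y₁)` over it, and an admissible step `Bl_C` (regular, `O`-flat, off the
generic point of `Y`, E1) through `x₁` after which every point over `x` is regular. (`nonregular_point_persists`, p500156.) [folklore] -/
theorem exists_useful_touch_of_horizChain_of_regularOver {O : Type} [CommRing O] [IsLocalRing O]
    {P : AlgebraicGeometry.Scheme.{0}} [AlgebraicGeometry.IsLocallyNoetherian P] (q : P ⟶ AlgebraicGeometry.Spec (.of O)) (Y : Set P)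
    {x : P} (hxY : x ∈ Y)
    (hx : ∃ w : ↥(AlgebraicGeometry.Scheme.IdealSheafData.vanishingIdeal (⟨closure Y, isClosed_closure⟩ : TopologicalSpace.Closeds P)).subscheme, (AlgebraicGeometry.Scheme.IdealSheafData.vanishingIdeal (⟨closure Y, isClosed_closure⟩ : TopologicalSpace.Closeds P)).subschemeι w = x ∧ ¬ IsRegularLocalRing ((AlgebraicGeometry.Scheme.IdealSheafData.vanishingIdeal (⟨closure Y, isClosed_closure⟩ : TopologicalSpace.Closeds P)).subscheme.presheaf.stalk w))
    {P' : AlgebraicGeometry.Scheme.{0}} {σ : P' ⟶ P} {S' : Set P'}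
    (hhr : (∀ Q : (∀ X' : AlgebraicGeometry.Scheme.{0}, (X' ⟶ P) → Set X' → Prop), Q P (CategoryTheory.CategoryStruct.id _) Y → (∀ (X' X'' : AlgebraicGeometry.Scheme.{0}) (σ' : X' ⟶ P) (Y' : Set X') (C : X'.IdealSheafData) (τ : X'' ⟶ X'), Q X' σ' Y' → Literature.AlgebraicGeometry.Resolution.IsBlowup τ C → Literature.AlgebraicGeometry.Resolution.Scheme.IsRegular C.subscheme → AlgebraicGeometry.Flat (CategoryTheory.CategoryStruct.comp C.subschemeι (CategoryTheory.CategoryStruct.comp σ' q)) → σ' '' (C.support : Set X') ⊆ {x | ¬ IsGenericPoint x Y} → (C.support : Set X') ∩ (CategoryTheory.CategoryStruct.comp σ' q) ⁻¹' {IsLocalRing.closedPoint O} ⊆ Y' → Q X'' (CategoryTheory.CategoryStruct.comp τ σ') (closure (τ ⁻¹' (Y' \ (C.support : Set X'))))) → Q P' σ S'))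
    (hregx : ∀ w : ↥(AlgebraicGeometry.Scheme.IdealSheafData.vanishingIdeal (⟨closure S', isClosed_closure⟩ : TopologicalSpace.Closeds P')).subscheme, σ ((AlgebraicGeometry.Scheme.IdealSheafData.vanishingIdeal (⟨closure S', isClosed_closure⟩ : TopologicalSpace.Closeds P')).subschemeι w) = x → IsRegularLocalRing ((AlgebraicGeometry.Scheme.IdealSheafData.vanishingIdeal (⟨closure S', isClosed_closure⟩ : TopologicalSpace.Closeds P')).subscheme.presheaf.stalk w)) :
    ∃ (X₁ : AlgebraicGeometry.Scheme.{0}) (σ₁ : X₁ ⟶ P) (Y₁ : Set X₁), (∀ Q : (∀ X' : AlgebraicGeometry.Scheme.{0}, (X' ⟶ P) → Set X' → Prop), Q P (CategoryTheory.CategoryStruct.id _) Y → (∀ (X' X'' : AlgebraicGeometry.Scheme.{0}) (σ' : X' ⟶ P) (Y' : Set X') (C : X'.IdealSheafData) (τ : X'' ⟶ X'), Q X' σ' Y' → Literature.AlgebraicGeometry.Resolution.IsBlowup τ C → Literature.AlgebraicGeometry.Resolution.Scheme.IsRegular C.subscheme → AlgebraicGeometry.Flat (CategoryTheory.CategoryStruct.comp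 C.subschemeι (CategoryTheory.CategoryStruct.comp σ' q)) → σ' '' (C.support : Set X') ⊆ {x | ¬ IsGenericPoint x Y} → (C.support : Set X') ∩ (CategoryTheory.CategoryStruct.comp σ' q) ⁻¹' {IsLocalRing.closedPoint O} ⊆ Y' → Q X'' (CategoryTheory.CategoryStruct.comp τ σ') (closure (τ ⁻¹' (Y' \ (C.support : Set X'))))) → Q X₁ σ₁ Y₁) ∧ ∃ x₁ : X₁, x₁ ∈ Y₁ ∧ σ₁ x₁ = x ∧ (∃ w : ↥(AlgebraicGeometry.Scheme.IdealSheafData.vanishingIdeal (⟨closure Y₁, isClosed_closure⟩ : TopologicalSpace.Closeds X₁)).subscheme, (AlgebraicGeometry.Scheme.IdealSheafData.vanishingIdeal (⟨closure Y₁, isClosed_closure⟩ : TopologicalSpace.Closeds X₁)).subschemeι w = x₁ ∧ ¬ IsRegularLocalRing ((AlgebraicGeometry.Scheme.IdealSheafData.vanishingIdeal (⟨closure Y₁, isClosed_closure⟩ : TopologicalSpace.Closeds X₁)).subscheme.presheaf.stalk w)) ∧ ∃ (C : X₁.IdealSheafData) (X₂ : AlgebraicGeometry.Scheme.{0}) (τ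 : X₂ ⟶ X₁), Literature.AlgebraicGeometry.Resolution.IsBlowup τ C ∧ Literature.AlgebraicGeometry.Resolution.Scheme.IsRegular C.subscheme ∧ AlgebraicGeometry.Flat (CategoryTheory.CategoryStruct.comp C.subschemeι (CategoryTheory.CategoryStruct.comp σ₁ q)) ∧ σ₁ '' (C.support : Set X₁) ⊆ {x | ¬ IsGenericPoint x Y} ∧ (C.support : Set X₁) ∩ (CategoryTheory.CategoryStruct.comp σ₁ q) ⁻¹' {IsLocalRing.closedPoint O} ⊆ Y₁ ∧ x₁ ∈ (C.support : Set X₁) ∧ (∀ w : ↥(AlgebraicGeometry.Scheme.IdealSheafData.vanishingIdeal (⟨closure (closure (τ ⁻¹' (Y₁ \ (C.support : Set X₁)))), isClosed_closure⟩ : TopologicalSpace.Closeds X₂)).subscheme, (CategoryTheory.CategoryStruct.comp τ σ₁) ((AlgebraicGeometry.Scheme.IdealSheafData.vanishingIdeal (⟨closure (closure (τ ⁻¹' (Y₁ \ (C.support : Set X₁)))), isClosed_closure⟩ : TopologicalSpace.Closeds X₂)).subschemeι w) = x → IsRegularLocalRing ((AlgebraicGeometry.Scheme.IdealSheafData.vanishingIdeal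 (⟨closure (closure (τ ⁻¹' (Y₁ \ (C.support : Set X₁)))), isClosed_closure⟩ : TopologicalSpace.Closeds X₂)).subscheme.presheaf.stalk w)) := by
  let HRp : ∀ X₁ : Scheme.{0}, (X₁ ⟶ P) → Set X₁ → Prop := fun X₁ σ₁ Y₁ => (∀ Q : (∀ X' : AlgebraicGeometry.Scheme.{0}, (X' ⟶ P) → Set X' → Prop), Q P (CategoryTheory.CategoryStruct.id _) Y → (∀ (X' X'' : AlgebraicGeometry.Scheme.{0}) (σ' : X' ⟶ P) (Y' : Set X') (C : X'.IdealSheafData) (τ : X'' ⟶ X'), Q X' σ' Y' → Literature.AlgebraicGeometry.Resolution.IsBlowup τ C → Literature.AlgebraicGeometry.Resolution.Scheme.IsRegular C.subscheme → AlgebraicGeometry.Flat (CategoryTheory.CategoryStruct.comp C.subschemeι (CategoryTheory.CategoryStruct.comp σ' q)) → σ' '' (C.support : Set X') ⊆ {x | ¬ IsGenericPoint x Y} → (C.support : Set X') ∩ (CategoryTheory.CategoryStruct.comp σ' q) ⁻¹' {IsLocalRing.closedPoint O} ⊆ Y' → Q X'' (CategoryTheory.CategoryStruct.comp τ σ') (closure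 (τ ⁻¹' (Y' \ (C.support : Set X'))))) → Q X₁ σ₁ Y₁)
  let NR : ∀ X' : Scheme.{0}, (X' ⟶ P) → Set X' → Prop := fun X' σ' Y' =>
    ∃ x' : X', x' ∈ Y' ∧ σ' x' = x ∧ (∃ w : ↥(AlgebraicGeometry.Scheme.IdealSheafData.vanishingIdeal (⟨closure Y', isClosed_closure⟩ : TopologicalSpace.Closeds X')).subscheme, (AlgebraicGeometry.Scheme.IdealSheafData.vanishingIdeal (⟨closure Y', isClosed_closure⟩ : TopologicalSpace.Closeds X')).subschemeι w = x' ∧ ¬ IsRegularLocalRing ((AlgebraicGeometry.Scheme.IdealSheafData.vanishingIdeal (⟨closure Y', isClosed_closure⟩ : TopologicalSpace.Closeds X')).subscheme.presheaf.stalk w))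
  have key := hhr (fun X' σ' Y' => IsLocallyNoetherian X' ∧ HRp X' σ' Y' ∧ ((∃ (X₁ : AlgebraicGeometry.Scheme.{0}) (σ₁ : X₁ ⟶ P) (Y₁ : Set X₁), (∀ Q : (∀ X' : AlgebraicGeometry.Scheme.{0}, (X' ⟶ P) → Set X' → Prop), Q P (CategoryTheory.CategoryStruct.id _) Y → (∀ (X' X'' : AlgebraicGeometry.Scheme.{0}) (σ' : X' ⟶ P) (Y' : Set X') (C : X'.IdealSheafData) (τ : X'' ⟶ X'), Q X' σ' Y' → Literature.AlgebraicGeometry.Resolution.IsBlowup τ C → Literature.AlgebraicGeometry.Resolution.Scheme.IsRegular C.subscheme → AlgebraicGeometry.Flat (CategoryTheory.CategoryStruct.comp C.subschemeι (CategoryTheory.CategoryStruct.comp σ' q)) → σ' '' (C.support : Set X') ⊆ {x | ¬ IsGenericPoint x Y} → (C.support : Set X') ∩ (CategoryTheory.CategoryStruct.comp σ' q) ⁻¹' {IsLocalRing.closedPoint O} ⊆ Y' → Q X'' (CategoryTheory.CategoryStruct.comp τ σ') (closure (τ ⁻¹' (Y' \ (C.support : Set X'))))) → Q X₁ σ₁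 Y₁) ∧ ∃ x₁ : X₁, x₁ ∈ Y₁ ∧ σ₁ x₁ = x ∧ (∃ w : ↥(AlgebraicGeometry.Scheme.IdealSheafData.vanishingIdeal (⟨closure Y₁, isClosed_closure⟩ : TopologicalSpace.Closeds X₁)).subscheme, (AlgebraicGeometry.Scheme.IdealSheafData.vanishingIdeal (⟨closure Y₁, isClosed_closure⟩ : TopologicalSpace.Closeds X₁)).subschemeι w = x₁ ∧ ¬ IsRegularLocalRing ((AlgebraicGeometry.Scheme.IdealSheafData.vanishingIdeal (⟨closure Y₁, isClosed_closure⟩ : TopologicalSpace.Closeds X₁)).subscheme.presheaf.stalk w)) ∧ ∃ (C : X₁.IdealSheafData) (X₂ : AlgebraicGeometry.Scheme.{0}) (τ : X₂ ⟶ X₁), Literature.AlgebraicGeometry.Resolution.IsBlowup τ C ∧ Literature.AlgebraicGeometry.Resolution.Scheme.IsRegular C.subscheme ∧ AlgebraicGeometry.Flat (CategoryTheory.CategoryStruct.comp C.subschemeι (CategoryTheory.CategoryStruct.comp σ₁ q)) ∧ σ₁ '' (C.support : Set X₁) ⊆ {x | ¬ IsGenericPoint x Y} ∧ (C.support : Set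 X₁) ∩ (CategoryTheory.CategoryStruct.comp σ₁ q) ⁻¹' {IsLocalRing.closedPoint O} ⊆ Y₁ ∧ x₁ ∈ (C.support : Set X₁) ∧ (∀ w : ↥(AlgebraicGeometry.Scheme.IdealSheafData.vanishingIdeal (⟨closure (closure (τ ⁻¹' (Y₁ \ (C.support : Set X₁)))), isClosed_closure⟩ : TopologicalSpace.Closeds X₂)).subscheme, (CategoryTheory.CategoryStruct.comp τ σ₁) ((AlgebraicGeometry.Scheme.IdealSheafData.vanishingIdeal (⟨closure (closure (τ ⁻¹' (Y₁ \ (C.support : Set X₁)))), isClosed_closure⟩ : TopologicalSpace.Closeds X₂)).subschemeι w) = x → IsRegularLocalRing ((AlgebraicGeometry.Scheme.IdealSheafData.vanishingIdeal (⟨closure (closure (τ ⁻¹' (Y₁ \ (C.support : Set X₁)))), isClosed_closure⟩ : TopologicalSpace.Closeds X₂)).subscheme.presheaf.stalk w))) ∨ NR X' σ' Y')) ?_ ?_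
  · obtain ⟨-, -, hF | ⟨x', -, hx'x, w, hw, hwreg⟩⟩ := key
    · exact hF
    · exact absurd (hregx w (by rw [hw, hx'x])) hwreg
  · exact ⟨inferInstance, fun Q h0 _ => h0, Or.inr ⟨x, hxY, by simp, hx⟩⟩
  · intro X' X'' σ' Y' C τ hQ hbl hC hflat hgen hE1
    obtain ⟨hN, hhr', hQ⟩ := hQ
    haveI := hN
    haveI : IsProper τ := hbl.isProper
    haveI : IsLocallyNoetherian X'' := LocallyOfFiniteType.isLocallyNoetherian τ
    have hhr'' : HRp X'' (CategoryTheory.CategoryStruct.comp τ σ') (closure (τ ⁻¹' (Y' \ (C.support : Set X')))) :=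
      fun Q h0 hs => hs X' X'' σ' Y' C τ (hhr' Q h0 hs) hbl hC hflat hgen hE1
    refine ⟨inferInstance, hhr'', ?_⟩
    rcases hQ with hF | ⟨x', hx'Y, hx'x, w, hw, hwreg⟩
    · exact Or.inl hF
    · by_cases hall : ∀ z : ↥(vanishingIdeal (⟨closure (closure (τ ⁻¹' (Y' \ (C.support : Set X')))), isClosed_closure⟩ : Closeds X'')).subscheme,
          (CategoryTheory.CategoryStruct.comp τ σ') ((vanishingIdeal (⟨closure (closure (τ ⁻¹' (Y' \ (C.support : Set X')))), isClosed_closure⟩ : Closeds X'')).subschemeι z) = x →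
          IsRegularLocalRing ((vanishingIdeal (⟨closure (closure (τ ⁻¹' (Y' \ (C.support : Set X')))), isClosed_closure⟩ : Closeds X'')).subscheme.presheaf.stalk z)
      · -- USEFUL TOUCH: every point over `x` is regular after this step; the surviving non-regular point lies in the centre
        have hx'C : x' ∈ (C.support : Set X') := by
          by_contra hx'C
          obtain ⟨x'', hx'', -, z, hz, hzreg⟩ := nonregular_point_persists τ C hbl Y' hx'Y hx'C w hw hwreg
          exact hzreg (hall z (by rw [hz, Scheme.Hom.comp_apply, hx'', hx'x]))
        exact Or.inl ⟨X', σ', Y', hhr', x', hx'Y, hx'x, ⟨w, hw, hwreg⟩, C, X'', τ, hbl, hC, hflat, hgen, hE1, hx'C, hall⟩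
      · -- a non-regular point over `x` survives
        push Not at hall
        obtain ⟨z, hzx, hzreg⟩ := hall
        refine Or.inr ⟨_, ?_, hzx, z, rfl, hzreg⟩
        have hz : (vanishingIdeal (⟨closure (closure (τ ⁻¹' (Y' \ (C.support : Set X')))), isClosed_closure⟩ : Closeds X'')).subschemeι z ∈
            closure (closure (τ ⁻¹' (Y' \ (C.support : Set X')))) := by
          have h := Set.mem_range_self (f := (vanishingIdeal (⟨closure (closure (τ ⁻¹' (Y' \ (C.support : Set X')))), isClosed_closure⟩ : Closeds X'')).subschemeι) z
          rw [ComponentGluing.range_subschemeι_vanishingIdeal] at h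
          exact h
        exact Eq.subset closure_closure hz

/-! ## FIRST PROGRESS touch with the weak end condition -/

/-- **THE FIRST PROGRESS TOUCH EXISTS AND SEES THE ORIGINAL LOCAL RING (general base).** `O` local, `q : P → Spec O` with `P` locally
Noetherian, `Y ⊆ P` with a generic point `ξ`, `w₀` a point of `V(closure Y)` over `x` whose local ring is NOT regular, and `(P′, σ, S′)`
a stage of the HORIZONTAL E1-closure of `(P, 𝟙, Y)` (steps: blow-up of a regular `O`-flat centre off the generic point of `Y`, E1) such
that every point of `V(closure S′)` OVER `x` is regular (the weak end condition of piece A, via `isRegularLocalRing_of_finite_singSet_of_infinite_closure`). Then there are a stage `(X₁, σ₁, Y₁)` of that closure (closure `Y₁` irreducible), its UNIQUE point `w₁` over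
`x`, a ring isomorphism `𝒪_{V(closure Y), w₀} ≃+* 𝒪_{V(closure Y₁), w₁}`, and an admissible step `τ : X₂ = Bl_C X₁ → X₁` with
`ι w₁ ∈ supp C`, `closure Y₁ ⊄ supp C` and NON-PRINCIPAL trace `(C·𝒪_{V(closure Y₁)})_{w₁}`. (Induction along the closure: while every
step is useless near the point over `x`, that point stays unique and its local ring unchanged — `exists_isIso_restrict_of_useless_step`;
a regular end forces a progress step.) [folklore] -/
theorem exists_first_progress_touch_of_horizChain_of_regularOver {O : Type} [CommRing O] [IsLocalRing O]
    {P : AlgebraicGeometry.Scheme.{0}} [AlgebraicGeometry.IsLocallyNoetherian P] (q : P ⟶ AlgebraicGeometry.Spec (.of O))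
    (Y : Set P) {ξ : P} (hξ : IsGenericPoint ξ Y) (x : P)
    (w₀ : ↥(AlgebraicGeometry.Scheme.IdealSheafData.vanishingIdeal (⟨closure Y, isClosed_closure⟩ : TopologicalSpace.Closeds P)).subscheme) (hw₀ : (AlgebraicGeometry.Scheme.IdealSheafData.vanishingIdeal (⟨closure Y, isClosed_closure⟩ : TopologicalSpace.Closeds P)).subschemeι w₀ = x)
    (hw₀reg : ¬ IsRegularLocalRing ((AlgebraicGeometry.Scheme.IdealSheafData.vanishingIdeal (⟨closure Y, isClosed_closure⟩ : TopologicalSpace.Closeds P)).subscheme.presheaf.stalk w₀))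
    {P' : AlgebraicGeometry.Scheme.{0}} {σ : P' ⟶ P} {S' : Set P'}
    (hhr : (∀ Q : (∀ X' : AlgebraicGeometry.Scheme.{0}, (X' ⟶ P) → Set X' → Prop), Q P (CategoryTheory.CategoryStruct.id _) Y → (∀ (X' X'' : AlgebraicGeometry.Scheme.{0}) (σ' : X' ⟶ P) (Y' : Set X') (C : X'.IdealSheafData) (τ : X'' ⟶ X'), Q X' σ' Y' → Literature.AlgebraicGeometry.Resolution.IsBlowup τ C → Literature.AlgebraicGeometry.Resolution.Scheme.IsRegular C.subscheme → AlgebraicGeometry.Flat (CategoryTheory.CategoryStruct.comp C.subschemeι (CategoryTheory.CategoryStruct.comp σ' q)) → σ' '' (C.support : Set X') ⊆ {x | ¬ IsGenericPoint x Y} → (C.support : Set X') ∩ (CategoryTheory.CategoryStruct.comp σ' q) ⁻¹' {IsLocalRing.closedPoint O} ⊆ Y' → Q X'' (CategoryTheory.CategoryStruct.comp τ σ') (closure (τ ⁻¹' (Y' \ (C.support : Set X'))))) → Q P' σ S'))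
    (hregx : ∀ w : ↥(AlgebraicGeometry.Scheme.IdealSheafData.vanishingIdeal (⟨closure S', isClosed_closure⟩ : TopologicalSpace.Closeds P')).subscheme, σ ((AlgebraicGeometry.Scheme.IdealSheafData.vanishingIdeal (⟨closure S', isClosed_closure⟩ : TopologicalSpace.Closeds P')).subschemeι w) = x → IsRegularLocalRing ((AlgebraicGeometry.Scheme.IdealSheafData.vanishingIdeal (⟨closure S', isClosed_closure⟩ : TopologicalSpace.Closeds P')).subscheme.presheaf.stalk w)) :
    ∃ (X₁ : AlgebraicGeometry.Scheme.{0}) (σ₁ : X₁ ⟶ P) (Y₁ : Set X₁), (∀ Q : (∀ X' : AlgebraicGeometry.Scheme.{0}, (X' ⟶ P) → Set X' → Prop), Q P (CategoryTheory.CategoryStruct.id _) Y → (∀ (X' X'' : AlgebraicGeometry.Scheme.{0}) (σ' : X' ⟶ P) (Y' : Set X') (C : X'.IdealSheafData) (τ : X'' ⟶ X'), Q X' σ' Y' → Literature.AlgebraicGeometry.Resolution.IsBlowup τ C → Literature.AlgebraicGeometry.Resolution.Scheme.IsRegular C.subscheme → AlgebraicGeometry.Flat (CategoryTheory.CategoryStruct.comp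 C.subschemeι (CategoryTheory.CategoryStruct.comp σ' q)) → σ' '' (C.support : Set X') ⊆ {x | ¬ IsGenericPoint x Y} → (C.support : Set X') ∩ (CategoryTheory.CategoryStruct.comp σ' q) ⁻¹' {IsLocalRing.closedPoint O} ⊆ Y' → Q X'' (CategoryTheory.CategoryStruct.comp τ σ') (closure (τ ⁻¹' (Y' \ (C.support : Set X'))))) → Q X₁ σ₁ Y₁) ∧
      IsIrreducible (closure Y₁) ∧
      ∃ (w₁ : ↥(AlgebraicGeometry.Scheme.IdealSheafData.vanishingIdeal (⟨closure Y₁, isClosed_closure⟩ : TopologicalSpace.Closeds X₁)).subscheme) (C : X₁.IdealSheafData) (X₂ : AlgebraicGeometry.Scheme.{0}) (τ : X₂ ⟶ X₁),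
        σ₁ ((AlgebraicGeometry.Scheme.IdealSheafData.vanishingIdeal (⟨closure Y₁, isClosed_closure⟩ : TopologicalSpace.Closeds X₁)).subschemeι w₁) = x ∧
        (∀ w' : ↥(AlgebraicGeometry.Scheme.IdealSheafData.vanishingIdeal (⟨closure Y₁, isClosed_closure⟩ : TopologicalSpace.Closeds X₁)).subscheme, σ₁ ((AlgebraicGeometry.Scheme.IdealSheafData.vanishingIdeal (⟨closure Y₁, isClosed_closure⟩ : TopologicalSpace.Closeds X₁)).subschemeι w') = x → w' = w₁) ∧
        Nonempty ((AlgebraicGeometry.Scheme.IdealSheafData.vanishingIdeal (⟨closure Y, isClosed_closure⟩ : TopologicalSpace.Closeds P)).subscheme.presheaf.stalk w₀ ≃+* (AlgebraicGeometry.Scheme.IdealSheafData.vanishingIdeal (⟨closure Y₁, isClosed_closure⟩ : TopologicalSpace.Closeds X₁)).subscheme.presheaf.stalk w₁) ∧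
        Literature.AlgebraicGeometry.Resolution.IsBlowup τ C ∧ Literature.AlgebraicGeometry.Resolution.Scheme.IsRegular C.subscheme ∧
        AlgebraicGeometry.Flat (CategoryTheory.CategoryStruct.comp C.subschemeι (CategoryTheory.CategoryStruct.comp σ₁ q)) ∧
        σ₁ '' (C.support : Set X₁) ⊆ {x | ¬ IsGenericPoint x Y} ∧
        (C.support : Set X₁) ∩ (CategoryTheory.CategoryStruct.comp σ₁ q) ⁻¹' {IsLocalRing.closedPoint O} ⊆ Y₁ ∧
        (AlgebraicGeometry.Scheme.IdealSheafData.vanishingIdeal (⟨closure Y₁, isClosed_closure⟩ : TopologicalSpace.Closeds X₁)).subschemeι w₁ ∈ (C.support : Set X₁) ∧ ¬ closure Y₁ ⊆ (C.support : Set X₁) ∧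
        ¬ (stalkIdeal (C.comap (AlgebraicGeometry.Scheme.IdealSheafData.vanishingIdeal (⟨closure Y₁, isClosed_closure⟩ : TopologicalSpace.Closeds X₁)).subschemeι) w₁).IsPrincipal := by
  -- the motive: (already FOUND) ∨ (NOT FOUND: a unique point over `x`, with unchanged local ring)
  let HRp : ∀ X₁ : Scheme.{0}, (X₁ ⟶ P) → Set X₁ → Prop := fun X₁ σ₁ Y₁ => (∀ Q : (∀ X' : AlgebraicGeometry.Scheme.{0}, (X' ⟶ P) → Set X' → Prop), Q P (CategoryTheory.CategoryStruct.id _) Y → (∀ (X' X'' : AlgebraicGeometry.Scheme.{0}) (σ' : X' ⟶ P) (Y' : Set X') (C : X'.IdealSheafData) (τ : X'' ⟶ X'), Q X' σ' Y' → Literature.AlgebraicGeometry.Resolution.IsBlowup τ C → Literature.AlgebraicGeometry.Resolution.Scheme.IsRegular C.subscheme → AlgebraicGeometry.Flat (CategoryTheory.CategoryStruct.comp C.subschemeι (CategoryTheory.CategoryStruct.comp σ' q)) → σ' '' (C.support : Set X') ⊆ {x | ¬ IsGenericPoint x Y} → (C.support : Set X') ∩ (CategoryTheory.CategoryStruct.comp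 σ' q) ⁻¹' {IsLocalRing.closedPoint O} ⊆ Y' → Q X'' (CategoryTheory.CategoryStruct.comp τ σ') (closure (τ ⁻¹' (Y' \ (C.support : Set X'))))) → Q X₁ σ₁ Y₁)
  let NF : ∀ X' : Scheme.{0}, (X' ⟶ P) → Set X' → Prop := fun X' σ' Y' =>
    ∃ w : ↥(AlgebraicGeometry.Scheme.IdealSheafData.vanishingIdeal (⟨closure Y', isClosed_closure⟩ : TopologicalSpace.Closeds X')).subscheme, σ' ((AlgebraicGeometry.Scheme.IdealSheafData.vanishingIdeal (⟨closure Y', isClosed_closure⟩ : TopologicalSpace.Closeds X')).subschemeι w) = x ∧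
      (∀ w' : ↥(AlgebraicGeometry.Scheme.IdealSheafData.vanishingIdeal (⟨closure Y', isClosed_closure⟩ : TopologicalSpace.Closeds X')).subscheme, σ' ((AlgebraicGeometry.Scheme.IdealSheafData.vanishingIdeal (⟨closure Y', isClosed_closure⟩ : TopologicalSpace.Closeds X')).subschemeι w') = x → w' = w) ∧
      Nonempty ((AlgebraicGeometry.Scheme.IdealSheafData.vanishingIdeal (⟨closure Y, isClosed_closure⟩ : TopologicalSpace.Closeds P)).subscheme.presheaf.stalk w₀ ≃+* (AlgebraicGeometry.Scheme.IdealSheafData.vanishingIdeal (⟨closure Y', isClosed_closure⟩ : TopologicalSpace.Closeds X')).subscheme.presheaf.stalk w)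
  have key := hhr (fun X' σ' Y' => IsLocallyNoetherian X' ∧ HRp X' σ' Y' ∧ ((∃ (X₁ : AlgebraicGeometry.Scheme.{0}) (σ₁ : X₁ ⟶ P) (Y₁ : Set X₁), (∀ Q : (∀ X' : AlgebraicGeometry.Scheme.{0}, (X' ⟶ P) → Set X' → Prop), Q P (CategoryTheory.CategoryStruct.id _) Y → (∀ (X' X'' : AlgebraicGeometry.Scheme.{0}) (σ' : X' ⟶ P) (Y' : Set X') (C : X'.IdealSheafData) (τ : X'' ⟶ X'), Q X' σ' Y' → Literature.AlgebraicGeometry.Resolution.IsBlowup τ C → Literature.AlgebraicGeometry.Resolution.Scheme.IsRegular C.subscheme → AlgebraicGeometry.Flat (CategoryTheory.CategoryStruct.comp C.subschemeι (CategoryTheory.CategoryStruct.comp σ' q)) → σ' '' (C.support : Set X') ⊆ {x | ¬ IsGenericPoint x Y} → (C.support : Set X') ∩ (CategoryTheory.CategoryStruct.comp σ' q) ⁻¹' {IsLocalRing.closedPoint O} ⊆ Y' → Q X'' (CategoryTheory.CategoryStruct.comp τ σ') (closure (τ ⁻¹' (Y' \ (C.support : Set X'))))) → Q X₁ σ₁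 Y₁) ∧
      IsIrreducible (closure Y₁) ∧
      ∃ (w₁ : ↥(AlgebraicGeometry.Scheme.IdealSheafData.vanishingIdeal (⟨closure Y₁, isClosed_closure⟩ : TopologicalSpace.Closeds X₁)).subscheme) (C : X₁.IdealSheafData) (X₂ : AlgebraicGeometry.Scheme.{0}) (τ : X₂ ⟶ X₁),
        σ₁ ((AlgebraicGeometry.Scheme.IdealSheafData.vanishingIdeal (⟨closure Y₁, isClosed_closure⟩ : TopologicalSpace.Closeds X₁)).subschemeι w₁) = x ∧
        (∀ w' : ↥(AlgebraicGeometry.Scheme.IdealSheafData.vanishingIdeal (⟨closure Y₁, isClosed_closure⟩ : TopologicalSpace.Closeds X₁)).subscheme, σ₁ ((AlgebraicGeometry.Scheme.IdealSheafData.vanishingIdeal (⟨closure Y₁, isClosed_closure⟩ : TopologicalSpace.Closeds X₁)).subschemeι w') = x → w' = w₁) ∧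
        Nonempty ((AlgebraicGeometry.Scheme.IdealSheafData.vanishingIdeal (⟨closure Y, isClosed_closure⟩ : TopologicalSpace.Closeds P)).subscheme.presheaf.stalk w₀ ≃+* (AlgebraicGeometry.Scheme.IdealSheafData.vanishingIdeal (⟨closure Y₁, isClosed_closure⟩ : TopologicalSpace.Closeds X₁)).subscheme.presheaf.stalk w₁) ∧
        Literature.AlgebraicGeometry.Resolution.IsBlowup τ C ∧ Literature.AlgebraicGeometry.Resolution.Scheme.IsRegular C.subscheme ∧
        AlgebraicGeometry.Flat (CategoryTheory.CategoryStruct.comp C.subschemeι (CategoryTheory.CategoryStruct.comp σ₁ q)) ∧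
        σ₁ '' (C.support : Set X₁) ⊆ {x | ¬ IsGenericPoint x Y} ∧
        (C.support : Set X₁) ∩ (CategoryTheory.CategoryStruct.comp σ₁ q) ⁻¹' {IsLocalRing.closedPoint O} ⊆ Y₁ ∧
        (AlgebraicGeometry.Scheme.IdealSheafData.vanishingIdeal (⟨closure Y₁, isClosed_closure⟩ : TopologicalSpace.Closeds X₁)).subschemeι w₁ ∈ (C.support : Set X₁) ∧ ¬ closure Y₁ ⊆ (C.support : Set X₁) ∧
        ¬ (stalkIdeal (C.comap (AlgebraicGeometry.Scheme.IdealSheafData.vanishingIdeal (⟨closure Y₁, isClosed_closure⟩ : TopologicalSpace.Closeds X₁)).subschemeι) w₁).IsPrincipal) ∨ NF X' σ' Y')) ?_ ?_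
  · obtain ⟨-, -, hF | ⟨w, hwx, -, ⟨e⟩⟩⟩ := key
    · exact hF
    · haveI := hregx w hwx
      exact absurd (IsRegularLocalRing.of_ringEquiv e.symm) hw₀reg
  · -- base `(P, 𝟙, Y)`
    refine ⟨inferInstance, fun Q h0 _ => h0, Or.inr ⟨w₀, by simpa using hw₀, ?_, ⟨RingEquiv.refl _⟩⟩⟩
    intro w' hw'
    apply (AlgebraicGeometry.Scheme.IdealSheafData.vanishingIdeal (⟨closure Y, isClosed_closure⟩ : TopologicalSpace.Closeds P)).subschemeι.isClosedEmbedding.injective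
    have hw'' : (AlgebraicGeometry.Scheme.IdealSheafData.vanishingIdeal (⟨closure Y, isClosed_closure⟩ : TopologicalSpace.Closeds P)).subschemeι w' = x := by
      simpa using hw'
    rw [hw'', hw₀]
  · intro X' X'' σ' Y' C τ hQ hbl hC hflat hgen hE1
    obtain ⟨hN, hhr', hQ⟩ := hQ
    haveI := hN
    haveI : IsProper τ := hbl.isProper
    haveI : IsLocallyNoetherian X'' := LocallyOfFiniteType.isLocallyNoetherian τ
    have hhr'' : HRp X'' (CategoryTheory.CategoryStruct.comp τ σ') (closure (τ ⁻¹' (Y' \ (C.support : Set X')))) :=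
      fun Q h0 hs => hs X' X'' σ' Y' C τ (hhr' Q h0 hs) hbl hC hflat hgen hE1
    refine ⟨inferInstance, hhr'', ?_⟩
    rcases hQ with hF | ⟨w, hwx, huniq, ⟨e⟩⟩
    · exact Or.inl hF
    · obtain ⟨hirr', hYC⟩ := isIrreducible_closure_and_not_subset_of_horizChain q Y hξ hhr' C hgen
      by_cases hprog : (AlgebraicGeometry.Scheme.IdealSheafData.vanishingIdeal (⟨closure Y', isClosed_closure⟩ : TopologicalSpace.Closeds X')).subschemeι w ∈ (C.support : Set X') ∧
          ¬ (stalkIdeal (C.comap (AlgebraicGeometry.Scheme.IdealSheafData.vanishingIdeal (⟨closure Y', isClosed_closure⟩ : TopologicalSpace.Closeds X')).subschemeι) w).IsPrincipal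
      · -- the FIRST PROGRESS touch is this step
        exact Or.inl ⟨X', σ', Y', hhr', hirr', w, C, X'', τ, hwx, huniq, ⟨e⟩, hbl, hC, hflat, hgen, hE1, hprog.1, hYC, hprog.2⟩
      · -- a useless step: the point over `x` stays unique with the same local ring
        have huse : (AlgebraicGeometry.Scheme.IdealSheafData.vanishingIdeal (⟨closure Y', isClosed_closure⟩ : TopologicalSpace.Closeds X')).subschemeι w ∉ (C.support : Set X') ∨
            (stalkIdeal (C.comap (AlgebraicGeometry.Scheme.IdealSheafData.vanishingIdeal (⟨closure Y', isClosed_closure⟩ : TopologicalSpace.Closeds X')).subschemeι) w).IsPrincipal := by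
          by_cases h1 : (AlgebraicGeometry.Scheme.IdealSheafData.vanishingIdeal (⟨closure Y', isClosed_closure⟩ : TopologicalSpace.Closeds X')).subschemeι w ∈ (C.support : Set X')
          · right; by_contra h2; exact hprog ⟨h1, h2⟩
          · exact Or.inl h1
        obtain ⟨ρ, hρτ, U, hwU, hiso⟩ :=
          exists_isIso_restrict_of_useless_step τ C hbl (closure Y') isClosed_closure hirr' hYC w huse
        have E : (⟨closure (closure (τ ⁻¹' (Y' \ (C.support : Set X')))), isClosed_closure⟩ : Closeds X'') =
            ⟨closure (τ ⁻¹' (closure Y' \ (C.support : Set X'))), isClosed_closure⟩ :=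
          Closeds.ext (show closure (closure (τ ⁻¹' (Y' \ (C.support : Set X')))) = closure (τ ⁻¹' (closure Y' \ (C.support : Set X'))) by
            rw [closure_closure]; exact closure_preimage_diff_support_eq_of_isBlowup hbl Y')
        suffices H : ∀ A : Closeds X'', A = ⟨closure (τ ⁻¹' (closure Y' \ (C.support : Set X'))), isClosed_closure⟩ →
            ∃ w'' : ↥(vanishingIdeal A).subscheme, (CategoryTheory.CategoryStruct.comp τ σ') ((vanishingIdeal A).subschemeι w'') = x ∧
              (∀ w' : ↥(vanishingIdeal A).subscheme, (CategoryTheory.CategoryStruct.comp τ σ') ((vanishingIdeal A).subschemeι w') = x → w' = w'') ∧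
              Nonempty ((AlgebraicGeometry.Scheme.IdealSheafData.vanishingIdeal (⟨closure Y, isClosed_closure⟩ : TopologicalSpace.Closeds P)).subscheme.presheaf.stalk w₀ ≃+* (vanishingIdeal A).subscheme.presheaf.stalk w'') by
          exact Or.inr (H _ E)
        rintro A rfl
        obtain ⟨w₂, hρw₂, huniq₂, hst⟩ := exists_unique_over_of_isIso_restrict ρ hwU hiso
        have hover : ∀ z, (CategoryTheory.CategoryStruct.comp τ σ')
            ((vanishingIdeal (⟨closure (τ ⁻¹' (closure Y' \ (C.support : Set X'))), isClosed_closure⟩ : Closeds X'')).subschemeι z) =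
            σ' ((AlgebraicGeometry.Scheme.IdealSheafData.vanishingIdeal (⟨closure Y', isClosed_closure⟩ : TopologicalSpace.Closeds X')).subschemeι (ρ z)) := by
          intro z
          have h := congrArg (fun φ => φ z) hρτ
          simp only [Scheme.Hom.comp_apply] at h ⊢
          rw [← h]
        refine ⟨w₂, by rw [hover, hρw₂, hwx], fun w' hw' => huniq₂ w' (huniq _ (by rw [← hover]; exact hw')), ?_⟩
        subst hρw₂
        exact ⟨e.trans (asIso (ρ.stalkMap w₂)).commRingCatIsoToRingEquiv⟩

/-! ## THE OBJECT for piece A: `ReachIsolatedAt` ⇒ the first progress touch sees the original singularity -/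

/-- **[OURS · L1 W4.5(b)] PIECE A ⇒ THE FIRST PROGRESS TOUCH SEES THE ORIGINAL SINGULARITY.** If `ReachIsolatedAt p k n H ι` (piece A of
res-L1-w45b-strat-1's stage cut; `GeFourReachIsolated p` is its `4 ≤ n` band = the registered refuter-facing stub `stub_elnat_ge_four_reach`),
`ι` a closed immersion of the integral `H`, and `h ∈ H` a point with NON-regular local ring and INFINITE closure (e.g. the generic point of a
positive-dimensional component of the non-regular locus), then over A's `(O, π)` and every `φ, Y`, writing `x := (ι ≫ Proj.map φ) h`: the
point `w₀` of `V(Y)` over `x` is non-regular, and there are a stage `(X₁, σ₁, Y₁)` of the horizontal E1-closure of `(ℙⁿ_O, 𝟙, Y)` (closure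
`Y₁` irreducible) whose UNIQUE point `w₁` over `x` has local ring `≃+* 𝒪_{V(Y), w₀}`, and an admissible step `Bl_C` (regular, `O`-flat, off
the generic point, E1) through `ι w₁` with NON-PRINCIPAL trace — the first progress touch over `x`. (Piece A's stage has finite `singSet`,
hence is regular at every point over `x` by `isRegularLocalRing_of_finite_singSet_of_infinite_closure`; then
`exists_first_progress_touch_of_horizChain_of_regularOver`.) [folklore] -/
theorem firstProgressTouch_of_reachIsolatedAt {p : ℕ} {k : Type} [Field k] [CharP k p] [IsAlgClosed k] {n : ℕ}
    {H : AlgebraicGeometry.Scheme.{0}} {ι : H ⟶ (Literature.AlgebraicGeometry.Motives.projectiveSpace n k).left}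
    (hA : ReachIsolatedAt p k n H ι) (hι : AlgebraicGeometry.IsClosedImmersion ι) (hH : AlgebraicGeometry.IsIntegral H)
    (h : H) (hreg : ¬ IsRegularLocalRing (H.presheaf.stalk h)) (hinf : (closure ({h} : Set H)).Infinite) :
    ∃ (O : Type) (_ : CommRing O) (_ : IsDomain O) (_ : IsDiscreteValuationRing O) (_ : CharZero O) (π : O →+* k), Function.Surjective π ∧ (letI := MvPolynomial.gradedAlgebra (σ := Fin (n + 1)) (R := O); letI := MvPolynomial.gradedAlgebra (σ := Fin (n + 1)) (R := k); ∀ (φ : MvPolynomial.homogeneousSubmodule (Fin (n + 1)) O →+*ᵍ MvPolynomial.homogeneousSubmodule (Fin (n + 1)) k) (hφ' : HomogeneousIdeal.irrelevant (MvPolynomial.homogeneousSubmodule (Fin (n + 1)) k) ≤ (HomogeneousIdeal.irrelevant (MvPolynomial.homogeneousSubmodule (Fin (n + 1)) O)).map φ), (∀ s, φ s = MvPolynomial.map π s) → ∀ Y : Set (AlgebraicGeometry.Proj (MvPolynomial.homogeneousSubmodule (Fin (n + 1)) O)), Y = Set.range (CategoryTheory.CategoryStruct.comp ι (AlgebraicGeometry.Proj.map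 φ hφ') : H ⟶ (AlgebraicGeometry.Proj (MvPolynomial.homogeneousSubmodule (Fin (n + 1)) O))) → ∃ w₀ : ↥(AlgebraicGeometry.Scheme.IdealSheafData.vanishingIdeal (⟨closure Y, isClosed_closure⟩ : TopologicalSpace.Closeds (AlgebraicGeometry.Proj (MvPolynomial.homogeneousSubmodule (Fin (n + 1)) O)))).subscheme, (AlgebraicGeometry.Scheme.IdealSheafData.vanishingIdeal (⟨closure Y, isClosed_closure⟩ : TopologicalSpace.Closeds (AlgebraicGeometry.Proj (MvPolynomial.homogeneousSubmodule (Fin (n + 1)) O)))).subschemeι w₀ = ((CategoryTheory.CategoryStruct.comp ι (AlgebraicGeometry.Proj.map φ hφ') : H ⟶ (AlgebraicGeometry.Proj (MvPolynomial.homogeneousSubmodule (Fin (n + 1)) O))) h) ∧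
      ¬ IsRegularLocalRing ((AlgebraicGeometry.Scheme.IdealSheafData.vanishingIdeal (⟨closure Y, isClosed_closure⟩ : TopologicalSpace.Closeds (AlgebraicGeometry.Proj (MvPolynomial.homogeneousSubmodule (Fin (n + 1)) O)))).subscheme.presheaf.stalk w₀) ∧
      ∃ (X₁ : AlgebraicGeometry.Scheme.{0}) (σ₁ : X₁ ⟶ (AlgebraicGeometry.Proj (MvPolynomial.homogeneousSubmodule (Fin (n + 1)) O))) (Y₁ : Set X₁), (∀ Q : (∀ X' : AlgebraicGeometry.Scheme.{0}, (X' ⟶ (AlgebraicGeometry.Proj (MvPolynomial.homogeneousSubmodule (Fin (n + 1)) O))) → Set X' → Prop), Q (AlgebraicGeometry.Proj (MvPolynomial.homogeneousSubmodule (Fin (n + 1)) O)) (CategoryTheory.CategoryStruct.id _) Y → (∀ (X' X'' : AlgebraicGeometry.Scheme.{0}) (σ' : X' ⟶ (AlgebraicGeometry.Proj (MvPolynomial.homogeneousSubmodule (Fin (n + 1)) O))) (Y' : Set X') (C : X'.IdealSheafData) (τ : X'' ⟶ X'), Q X' σ' Y' → Literature.AlgebraicGeometry.Resolution.IsBlowup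 τ C → Literature.AlgebraicGeometry.Resolution.Scheme.IsRegular C.subscheme → AlgebraicGeometry.Flat (CategoryTheory.CategoryStruct.comp C.subschemeι (CategoryTheory.CategoryStruct.comp σ' (CategoryTheory.CategoryStruct.comp (AlgebraicGeometry.Proj.toSpecZero (MvPolynomial.homogeneousSubmodule (Fin (n + 1)) O)) (AlgebraicGeometry.Spec.map (CommRingCat.ofHom (algebraMap O (MvPolynomial.homogeneousSubmodule (Fin (n + 1)) O 0))))))) → σ' '' (C.support : Set X') ⊆ {x | ¬ IsGenericPoint x Y} → (C.support : Set X') ∩ (CategoryTheory.CategoryStruct.comp σ' (CategoryTheory.CategoryStruct.comp (AlgebraicGeometry.Proj.toSpecZero (MvPolynomial.homogeneousSubmodule (Fin (n + 1)) O)) (AlgebraicGeometry.Spec.map (CommRingCat.ofHom (algebraMap O (MvPolynomial.homogeneousSubmodule (Fin (n + 1)) O 0)))))) ⁻¹' {IsLocalRing.closedPoint O} ⊆ Y' → Q X'' (CategoryTheory.CategoryStruct.comp τ σ') (closure (τ ⁻¹' (Y' \ (C.support : Set X'))))) → Q X₁ σ₁ Y₁) ∧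
      IsIrreducible (closure Y₁) ∧
      ∃ (w₁ : ↥(AlgebraicGeometry.Scheme.IdealSheafData.vanishingIdeal (⟨closure Y₁, isClosed_closure⟩ : TopologicalSpace.Closeds X₁)).subscheme) (C : X₁.IdealSheafData) (X₂ : AlgebraicGeometry.Scheme.{0}) (τ : X₂ ⟶ X₁),
        σ₁ ((AlgebraicGeometry.Scheme.IdealSheafData.vanishingIdeal (⟨closure Y₁, isClosed_closure⟩ : TopologicalSpace.Closeds X₁)).subschemeι w₁) = ((CategoryTheory.CategoryStruct.comp ι (AlgebraicGeometry.Proj.map φ hφ') : H ⟶ (AlgebraicGeometry.Proj (MvPolynomial.homogeneousSubmodule (Fin (n + 1)) O))) h) ∧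
        (∀ w' : ↥(AlgebraicGeometry.Scheme.IdealSheafData.vanishingIdeal (⟨closure Y₁, isClosed_closure⟩ : TopologicalSpace.Closeds X₁)).subscheme, σ₁ ((AlgebraicGeometry.Scheme.IdealSheafData.vanishingIdeal (⟨closure Y₁, isClosed_closure⟩ : TopologicalSpace.Closeds X₁)).subschemeι w') = ((CategoryTheory.CategoryStruct.comp ι (AlgebraicGeometry.Proj.map φ hφ') : H ⟶ (AlgebraicGeometry.Proj (MvPolynomial.homogeneousSubmodule (Fin (n + 1)) O))) h) → w' = w₁) ∧
        Nonempty ((AlgebraicGeometry.Scheme.IdealSheafData.vanishingIdeal (⟨closure Y, isClosed_closure⟩ : TopologicalSpace.Closeds (AlgebraicGeometry.Proj (MvPolynomial.homogeneousSubmodule (Fin (n + 1)) O)))).subscheme.presheaf.stalk w₀ ≃+* (AlgebraicGeometry.Scheme.IdealSheafData.vanishingIdeal (⟨closure Y₁, isClosed_closure⟩ : TopologicalSpace.Closeds X₁)).subscheme.presheaf.stalk w₁) ∧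
        Literature.AlgebraicGeometry.Resolution.IsBlowup τ C ∧ Literature.AlgebraicGeometry.Resolution.Scheme.IsRegular C.subscheme ∧
        AlgebraicGeometry.Flat (CategoryTheory.CategoryStruct.comp C.subschemeι (CategoryTheory.CategoryStruct.comp σ₁ (CategoryTheory.CategoryStruct.comp (AlgebraicGeometry.Proj.toSpecZero (MvPolynomial.homogeneousSubmodule (Fin (n + 1)) O)) (AlgebraicGeometry.Spec.map (CommRingCat.ofHom (algebraMap O (MvPolynomial.homogeneousSubmodule (Fin (n + 1)) O 0))))))) ∧
        σ₁ '' (C.support : Set X₁) ⊆ {x | ¬ IsGenericPoint x Y} ∧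
        (C.support : Set X₁) ∩ (CategoryTheory.CategoryStruct.comp σ₁ (CategoryTheory.CategoryStruct.comp (AlgebraicGeometry.Proj.toSpecZero (MvPolynomial.homogeneousSubmodule (Fin (n + 1)) O)) (AlgebraicGeometry.Spec.map (CommRingCat.ofHom (algebraMap O (MvPolynomial.homogeneousSubmodule (Fin (n + 1)) O 0)))))) ⁻¹' {IsLocalRing.closedPoint O} ⊆ Y₁ ∧
        (AlgebraicGeometry.Scheme.IdealSheafData.vanishingIdeal (⟨closure Y₁, isClosed_closure⟩ : TopologicalSpace.Closeds X₁)).subschemeι w₁ ∈ (C.support : Set X₁) ∧ ¬ closure Y₁ ⊆ (C.support : Set X₁) ∧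
        ¬ (stalkIdeal (C.comap (AlgebraicGeometry.Scheme.IdealSheafData.vanishingIdeal (⟨closure Y₁, isClosed_closure⟩ : TopologicalSpace.Closeds X₁)).subschemeι) w₁).IsPrincipal) := by
  obtain ⟨O, i1, i2, i3, i4, i5, π, hπ, h'⟩ := hA
  refine ⟨O, i1, i2, i3, i4, π, hπ, ?_⟩
  letI := MvPolynomial.gradedAlgebra (σ := Fin (n + 1)) (R := O)
  letI := MvPolynomial.gradedAlgebra (σ := Fin (n + 1)) (R := k)
  intro φ hφ' hφ Y hY
  haveI := hH
  obtain ⟨X₁, σ₁, S₁, hreach, hfin, -⟩ := h' φ hφ' hφ Y hY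
  -- the base `q : ℙⁿ_O → Spec O` is proper, hence `ℙⁿ_O` is locally Noetherian
  obtain ⟨-, hprop⟩ := stub_projectiveAmbientSmoothProper O n
  haveI : IsProper (CategoryTheory.CategoryStruct.comp (AlgebraicGeometry.Proj.toSpecZero (MvPolynomial.homogeneousSubmodule (Fin (n + 1)) O)) (AlgebraicGeometry.Spec.map (CommRingCat.ofHom (algebraMap O (MvPolynomial.homogeneousSubmodule (Fin (n + 1)) O 0))))) := hprop
  haveI : IsNoetherianRing (CommRingCat.of O) := inferInstanceAs (IsNoetherianRing O)
  haveI : IsLocallyNoetherian (AlgebraicGeometry.Proj (MvPolynomial.homogeneousSubmodule (Fin (n + 1)) O)) := LocallyOfFiniteType.isLocallyNoetherian (CategoryTheory.CategoryStruct.comp (AlgebraicGeometry.Proj.toSpecZero (MvPolynomial.homogeneousSubmodule (Fin (n + 1)) O)) (AlgebraicGeometry.Spec.map (CommRingCat.ofHom (algebraMap O (MvPolynomial.homogeneousSubmodule (Fin (n + 1)) O 0)))))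
  -- the comparison `g : ℙⁿ_k → ℙⁿ_O` is a closed immersion, so `Y = range (ι ≫ g)` is closed with generic point the image of `η_H`
  set g : Proj (MvPolynomial.homogeneousSubmodule (Fin (n + 1)) k) ⟶ (AlgebraicGeometry.Proj (MvPolynomial.homogeneousSubmodule (Fin (n + 1)) O)) := Proj.map φ hφ' with hg
  have hP := ProjectiveAmbientFibre.isPullback_projMap π φ hφ hπ hφ'
  haveI : IsClosedImmersion (Spec.map (CommRingCat.ofHom π)) := IsClosedImmersion.spec_of_surjective _ hπ
  haveI hgci : IsClosedImmersion g := MorphismProperty.IsStableUnderBaseChange.of_isPullback hP.flip inferInstance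
  let ι' : H ⟶ Proj (MvPolynomial.homogeneousSubmodule (Fin (n + 1)) k) := ι
  haveI : IsClosedImmersion ι' := hι
  have hYcl : IsClosed Y := by rw [hY]; exact (ι' ≫ g).isClosedEmbedding.isClosed_range
  have hξ : IsGenericPoint ((ι' ≫ g) (genericPoint H)) Y := by
    have h1 := (genericPoint_spec H).image (ι' ≫ g).base.hom.continuous
    rw [Set.image_univ] at h1
    have h2 : closure (Set.range ⇑(ι' ≫ g)) = Y := by
      have e : Set.range ⇑(ι' ≫ g) = Y := hY.symm
      rw [e]; exact hYcl.closure_eq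
    rw [h2] at h1
    exact h1
  -- the non-regular point of `V(closure Y)` over `x` (pv-003's bridge)
  have hci := @IsClosedImmersion.comp _ _ _ ι _ hι hgci
  obtain ⟨w₀, hw₀, hw₀reg⟩ := @exists_vanishingIdeal_witness_of_not_isRegularLocalRing _ _ _ hci inferInstance _ hreg
  -- the stage of piece A is regular OVER `x`: `σ₁` is proper, so points over `x` have infinite closure
  have hpropσ : IsProper σ₁ :=
    (hReach_induction (fun X' σ' _ => IsLocallyNoetherian X' ∧ IsProper σ')
      ⟨inferInstance, (inferInstance : IsProper (CategoryTheory.CategoryStruct.id (AlgebraicGeometry.Proj (MvPolynomial.homogeneousSubmodule (Fin (n + 1)) O))))⟩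
      (fun X' X'' σ' Y' C τ hQ hbl _ _ _ _ => by
        obtain ⟨hN, hP'⟩ := hQ
        haveI := hN
        haveI := hP'
        haveI : IsProper τ := hbl.isProper
        haveI : IsLocallyNoetherian X'' := LocallyOfFiniteType.isLocallyNoetherian τ
        exact ⟨inferInstance, inferInstance⟩) hreach).2
  have hxinf : (closure ({(ι' ≫ g) h} : Set (AlgebraicGeometry.Proj (MvPolynomial.homogeneousSubmodule (Fin (n + 1)) O)))).Infinite :=
    infinite_closure_of_injective (ι' ≫ g).continuous (ι' ≫ g).isClosedEmbedding.injective h hinf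
  have hregx : ∀ w : ↥(AlgebraicGeometry.Scheme.IdealSheafData.vanishingIdeal (⟨closure S₁, isClosed_closure⟩ : TopologicalSpace.Closeds X₁)).subscheme,
      σ₁ ((AlgebraicGeometry.Scheme.IdealSheafData.vanishingIdeal (⟨closure S₁, isClosed_closure⟩ : TopologicalSpace.Closeds X₁)).subschemeι w) = (ι' ≫ g) h →
      IsRegularLocalRing ((AlgebraicGeometry.Scheme.IdealSheafData.vanishingIdeal (⟨closure S₁, isClosed_closure⟩ : TopologicalSpace.Closeds X₁)).subscheme.presheaf.stalk w) := by
    intro w hw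
    haveI := hpropσ
    refine isRegularLocalRing_of_finite_singSet_of_infinite_closure S₁ hfin w ?_
    refine infinite_closure_of_isClosedMap
      (CategoryTheory.CategoryStruct.comp (AlgebraicGeometry.Scheme.IdealSheafData.vanishingIdeal (⟨closure S₁, isClosed_closure⟩ : TopologicalSpace.Closeds X₁)).subschemeι σ₁).continuous
      (CategoryTheory.CategoryStruct.comp (AlgebraicGeometry.Scheme.IdealSheafData.vanishingIdeal (⟨closure S₁, isClosed_closure⟩ : TopologicalSpace.Closeds X₁)).subschemeι σ₁).isClosedMap w ?_
    rw [Scheme.Hom.comp_apply, hw]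
    exact hxinf
  subst hY
  exact ⟨w₀, hw₀, hw₀reg, exists_first_progress_touch_of_horizChain_of_regularOver (CategoryTheory.CategoryStruct.comp (AlgebraicGeometry.Proj.toSpecZero (MvPolynomial.homogeneousSubmodule (Fin (n + 1)) O)) (AlgebraicGeometry.Spec.map (CommRingCat.ofHom (algebraMap O (MvPolynomial.homogeneousSubmodule (Fin (n + 1)) O 0))))) _ hξ _ w₀ hw₀ hw₀reg hreach hregx⟩

end Summit.ResolutionOfSingularities.ResolutionOfSingularities.Cruxes.EquisingularLiftNat.Sections
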